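import Literature.NumberTheory.LFunctions.RamareLOneOddSmoothing
import Literature.Analysis.Fourier.FejerHarmonicSum
import HarnessLib

/-!
# Ramaré 2001, Corollary 1 (odd characters): `|L(1,χ)| ≤ ½ log q + 5/2 − log 6`

Everything in this file is PROVED (theorems only; standard axioms).  Main result:
`Ramare2001.norm_LFunction_one_le_half_log_add_of_odd` — for every ODD primitive Dirichlet character
`χ` mod `q`, `‖L(1,χ)‖ ≤ ½ log q + (5/2 − log 6)` (`= ½ log q + 0.7082…`); `ramare2001_corollary1_odd`
is the odd conjunct of the named fact `Literature.NumberTheory.LFunctions.ramare2001_corollary1` in its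
quantified shape.  Together with `RamareLOneEvenSmoothing.ramare2001_corollary1_even` this discharges
that fact.

Road (Ramaré, Acta Arith. 100 (2001), §VI «A second smoothing for odd characters», p. 263), with an
INTEGER smoothing parameter `δq = N`:

* `sum_fejerDualP_eq` : `Σ_{m<q} P((m+1)/N) = (N−1)(2N−1)/(6N)` for the dual polynomial
  `P(y) = (1 − min(y,1))²` (exact, instead of Lemma 10);
* `norm_LFunction_one_le_of_odd_param` : for `1 ≤ N ≤ q/2`, from Proposition 2
  (`RamareLOneOddSmoothing.LFunction_one_eq_fejer_add_dual`), Lemma 17 in upper-bound form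
  (`FejerHarmonicSum.tsum_sinc_sq_div_le`) and `|τ(χ)| = √q`:
  `‖L(1,χ)‖ ≤ −log(2πN/q) + 3/2 + ε + (π/√q)(N/3 − 1/2 + 1/(6N))`, `ε = (πN/q)²/(6(6 − (πN/q)²))`;
* `norm_LFunction_one_le_of_odd_small` (`q ≤ 6`, `N = 1`) and `norm_LFunction_one_le_of_odd_large`
  (`q ≥ 7`, `N = ⌊3√q/π⌋` — Ramaré's «`πδ√q/3 = 1`»), where the final inequality reduces to
  `2(a − N)² − 3N + 1 + 2aNε ≤ 0` for `a = 3√q/π ∈ [N, N+1)`, `N ≥ 2`, `aNε ≤ 567/(198π²)`.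

Deviation from print: Ramaré obtains (6.5) `½ log q + 5/2 − log 6 − 5/(4√q)` for `q ≥ 300` and
completes Corollary 1 by direct computation for small `q`; choosing `δq` integral makes the dual sum
exact and gives Corollary 1 for every `q` without numerics (the constant `5/2 − log 6` is unchanged).

## References

* O. Ramaré, *Approximate formulae for L(1,χ)*, Acta Arith. 100 (2001) 245–266: Prop. 2 and Cor. 1
  pp. 247–248, Lemmas 17–18 pp. 260–261, (6.5) p. 263. [cite: Ramare2001LOneApproximateFormulae, Cor. 1 p. 248]
-/

noncomputable section

open Real Filter Topology Set MeasureTheory intervalIntegral Finset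
open Literature.Analysis.Fourier

namespace Literature.NumberTheory.LFunctions.Ramare2001

variable {q : ℕ} [NeZero q] (χ : DirichletCharacter ℂ q)

/-! ## The dual sum `Σ_{m ≤ q} (1 − m/N)₊² = (N−1)(2N−1)/(6N)` -/

/-- `Σ_{m<N} m = N(N−1)/2` in `ℝ`. [folklore] -/
private theorem sum_range_natCast (N : ℕ) : ∑ m ∈ Finset.range N, (m:ℝ) = (N:ℝ) * (N - 1) / 2 := by
  induction N with
  | zero => simp
  | succ n ih => rw [Finset.sum_range_succ, ih]; push_cast; ring

/-- `Σ_{m<N} m² = N(N−1)(2N−1)/6` in `ℝ`. [folklore] -/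
private theorem sum_range_natCast_sq (N : ℕ) :
    ∑ m ∈ Finset.range N, ((m:ℝ)) ^ 2 = (N:ℝ) * (N - 1) * (2 * N - 1) / 6 := by
  induction N with
  | zero => simp
  | succ n ih => rw [Finset.sum_range_succ, ih]; push_cast; ring

variable {P : ℝ → ℝ}

omit [NeZero q] in
/-- **The dual sum for `δq = N`**: `Σ_{m<q} P((m+1)/N) = (N−1)(2N−1)/(6N)` for `1 ≤ N ≤ q`.
[cite: Ramare2001LOneApproximateFormulae, §VI p. 263 («Σ_{1≤m≤δq} π(m/(δq) − 1)²»)] -/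
theorem sum_fejerDualP_eq (hP : P = fun y => ∫ u in y..1, 2 * (1 - min u 1)) {N : ℕ}
    (hN : 1 ≤ N) (hNq : N ≤ q) :
    ∑ m ∈ Finset.range q, P (((m:ℝ) + 1) / N) = ((N:ℝ) - 1) * (2 * N - 1) / (6 * N) := by
  have hN0 : (0:ℝ) < N := by exact_mod_cast hN
  rw [← Finset.sum_range_add_sum_Ico _ hNq]
  have h2 : ∑ m ∈ Finset.Ico N q, P (((m:ℝ) + 1) / N) = 0 := by
    refine Finset.sum_eq_zero fun m hm => ?_
    rw [Finset.mem_Ico] at hm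
    refine fejerDualP_eq_zero hP ?_
    rw [le_div_iff₀ hN0, one_mul]
    have : (N:ℝ) ≤ m := by exact_mod_cast hm.1
    linarith
  have h1 : ∑ m ∈ Finset.range N, P (((m:ℝ) + 1) / N)
      = ∑ m ∈ Finset.range N, (((N:ℝ) - 1) ^ 2 - 2 * ((N:ℝ) - 1) * m + (m:ℝ) ^ 2) / (N:ℝ) ^ 2 := by
    refine Finset.sum_congr rfl fun m hm => ?_
    rw [Finset.mem_range] at hm
    have hle : ((m:ℝ) + 1) / N ≤ 1 := by
      rw [div_le_one hN0]; exact_mod_cast hm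
    rw [fejerDualP_eq hP hle]
    field_simp
    ring
  rw [h2, add_zero, h1, ← Finset.sum_div, Finset.sum_add_distrib, Finset.sum_sub_distrib,
    Finset.sum_const, Finset.card_range, nsmul_eq_mul, ← Finset.mul_sum, sum_range_natCast,
    sum_range_natCast_sq]
  field_simp
  ring

/-! ## The bound for a given integer `N = δq` -/

/-- **Odd characters, smoothing parameter `δ = N/q`**: for `χ` odd primitive mod `q` and an integer
`1 ≤ N ≤ q/2`,
`|L(1,χ)| ≤ −log(2πN/q) + 3/2 + (πN/q)²/(6(6 − (πN/q)²)) + (π/√q)(N/3 − 1/2 + 1/(6N))`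
(Proposition 2 with `F₄`, Lemma 17 (upper form), `|τ(χ)| = √q`, and the exact dual sum).
[cite: Ramare2001LOneApproximateFormulae, §VI pp. 262–263 (second smoothing for odd characters)] -/
theorem norm_LFunction_one_le_of_odd_param (hχ : χ.IsPrimitive) (hodd : χ.Odd) {N : ℕ}
    (hN : 1 ≤ N) (hNq : 2 * N ≤ q) :
    ‖χ.LFunction 1‖ ≤ -Real.log (2 * π * ((N:ℝ) / q)) + 3 / 2
      + (π * ((N:ℝ) / q)) ^ 2 / (6 * (6 - (π * ((N:ℝ) / q)) ^ 2))
      + π / Real.sqrt q * ((N:ℝ) / 3 - 1 / 2 + 1 / (6 * N)) := by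
  have hχ1 : χ ≠ 1 := by
    rintro rfl
    have h : (1 : DirichletCharacter ℂ q) (-1) = -1 := hodd
    rw [MulChar.one_apply (isUnit_one.neg)] at h
    norm_num at h
  have hqne : q ≠ 0 := NeZero.ne q
  have hq0 : (0:ℝ) < q := by positivity
  have hN0 : (0:ℝ) < N := by exact_mod_cast hN
  have hNq' : (N:ℝ) ≤ q := by exact_mod_cast (le_trans (Nat.le_mul_of_pos_left N two_pos) hNq)
  have h2N : 2 * (N:ℝ) ≤ q := by exact_mod_cast hNq
  set P : ℝ → ℝ := fun y => ∫ u in y..1, 2 * (1 - min u 1) with hP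
  set δ : ℝ := (N:ℝ) / q with hδ
  have hδ0 : 0 < δ := by positivity
  have hδhalf : δ ≤ 1 / 2 := by rw [hδ, div_le_iff₀ hq0]; linarith
  have hδ1 : δ < 1 := by linarith
  have hδq : δ * q = N := by rw [hδ]; field_simp
  set s : ℝ := Real.sqrt q with hs
  have hs0 : 0 < s := Real.sqrt_pos.2 hq0
  have hsq : s ^ 2 = q := Real.sq_sqrt hq0.le
  have hformula := LFunction_one_eq_fejer_add_dual χ hχ hχ1 hodd hP hδ0 hδ1
  -- the smoothed sum
  have hA : ‖∑' n : ℕ, χ ((n + 1 : ℕ) : ZMod q) *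
      ((Real.sinc (π * (δ * (n + 1))) ^ 2 / (n + 1) : ℝ) : ℂ)‖
        ≤ -Real.log (2 * π * δ) + 3 / 2 + (π * δ) ^ 2 / (6 * (6 - (π * δ) ^ 2)) := by
    refine (tsum_of_norm_bounded (summable_sinc_sq_div hδ0).hasSum fun n => ?_).trans
      (tsum_sinc_sq_div_le hδ0 hδhalf)
    rw [norm_mul, Complex.norm_real, Real.norm_eq_abs, abs_of_nonneg (by positivity)]
    exact mul_le_of_le_one_left (by positivity) (χ.norm_le_one _)
  -- the dual sum
  have hτ : ‖gaussSum χ (ZMod.stdAddChar (N := q))‖ = s := by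
    rw [← Real.sqrt_sq (norm_nonneg _), Literature.NumberTheory.Sieve.LargeSieve.norm_gaussSum_sq hχ]
  have hPnn : ∀ m : ℕ, 0 ≤ P (((m:ℝ) + 1) / N) := fun m => fejerDualP_nonneg hP _
  have hD := sum_fejerDualP_eq hP hN (le_trans (Nat.le_mul_of_pos_left N two_pos) hNq)
  have hT : ‖(π * Complex.I * gaussSum χ (ZMod.stdAddChar (N := q)) / q) *
      ∑ m ∈ Finset.range q, χ⁻¹ ((m + 1 : ℕ) : ZMod q) * (P ((m + 1) / (δ * q)) : ℂ)‖
        ≤ π / s * ((N:ℝ) / 3 - 1 / 2 + 1 / (6 * N)) := by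
    rw [norm_mul, norm_div, norm_mul, norm_mul, hτ, Complex.norm_real, Complex.norm_I,
      Complex.norm_natCast, Real.norm_eq_abs, abs_of_pos Real.pi_pos, mul_one, hδq]
    have h1 : ‖∑ m ∈ Finset.range q, χ⁻¹ ((m + 1 : ℕ) : ZMod q) * (P ((m + 1) / N) : ℂ)‖
        ≤ ∑ m ∈ Finset.range q, P (((m:ℝ) + 1) / N) := by
      refine (norm_sum_le _ _).trans (Finset.sum_le_sum fun m _ => ?_)
      rw [norm_mul, Complex.norm_real, Real.norm_eq_abs, abs_of_nonneg (hPnn m)]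
      exact mul_le_of_le_one_left (hPnn m) (DirichletCharacter.norm_le_one _ _)
    rw [hD] at h1
    have h2 : π * s / q = π / s := by rw [← hsq]; field_simp
    rw [h2]
    have h3 : ((N:ℝ) - 1) * (2 * N - 1) / (6 * N) = (N:ℝ) / 3 - 1 / 2 + 1 / (6 * N) := by
      field_simp; ring
    rw [← h3]
    exact mul_le_mul_of_nonneg_left h1 (by positivity)
  calc ‖χ.LFunction 1‖ ≤ _ + _ := by rw [hformula]; exact (norm_sub_le _ _).trans (add_le_add hA hT)
    _ = _ := by rw [hs]

/-! ## Corollary 1, odd characters -/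

/-- `log π − log 3 > 0.045` (from `log y ≥ 1 − 1/y` at `y = π/3`). [folklore] -/
private theorem log_pi_sub_log_three_gt : (0.045 : ℝ) < Real.log π - Real.log 3 := by
  have hπ := Real.pi_gt_d6
  have h := Real.one_sub_inv_le_log_of_pos (show (0:ℝ) < π / 3 by positivity)
  rw [Real.log_div Real.pi_ne_zero (by norm_num), inv_div] at h
  have h2 : 3 / π < 0.955 := by
    rw [div_lt_iff₀ Real.pi_pos]; nlinarith
  linarith

/-- Monotonicity of `x² ↦ x²/(6(6 − x²))` below `6`. [folklore] -/
private theorem sq_div_le {x B : ℝ} (hx : x ^ 2 ≤ B) (hB : B < 6) :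
    x ^ 2 / (6 * (6 - x ^ 2)) ≤ B / (6 * (6 - B)) :=
  div_le_div₀ (le_trans (sq_nonneg x) hx) hx (by nlinarith) (by nlinarith)

/-- The elementary inequality behind the choice `N = ⌊3√q/π⌋`. [folklore] -/
private theorem odd_large_ineq {a n ε : ℝ} (hn : 2 ≤ n) (hna : n ≤ a) (han : a < n + 1)
    (hε : a * n * ε ≤ 1) :
    a / n - 2 + ε + 3 / a * (n / 3 - 1 / 2 + 1 / (6 * n)) ≤ 0 := by
  have ha : 0 < a := by linarith
  have hn0 : 0 < n := by linarith
  have h1 : (a - n) ^ 2 ≤ 1 := by nlinarith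
  have key : 2 * (a - n) ^ 2 - 3 * n + 1 + 2 * a * n * ε ≤ 0 := by nlinarith
  have expand : a / n - 2 + ε + 3 / a * (n / 3 - 1 / 2 + 1 / (6 * n))
      = (2 * (a - n) ^ 2 - 3 * n + 1 + 2 * a * n * ε) / (2 * a * n) := by
    field_simp; ring
  rw [expand, div_le_iff₀ (by positivity), zero_mul]
  exact key

/-- **Small conductors** (`q ≤ 6`, `δ = 1/q`): `|L(1,χ)| ≤ ½ log q + 5/2 − log 6` for odd primitive
`χ`. [cite: Ramare2001LOneApproximateFormulae, Cor. 1 p. 248] -/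
theorem norm_LFunction_one_le_of_odd_small (hχ : χ.IsPrimitive) (hodd : χ.Odd) (hq : q ≤ 6) :
    ‖χ.LFunction 1‖ ≤ Real.log q / 2 + (5 / 2 - Real.log 6) := by
  have hχ1 : χ ≠ 1 := by
    rintro rfl
    have h : (1 : DirichletCharacter ℂ q) (-1) = -1 := hodd
    rw [MulChar.one_apply (isUnit_one.neg)] at h
    norm_num at h
  have hq1 : q ≠ 1 := by rintro rfl; exact hχ1 χ.level_one
  have hqne : q ≠ 0 := NeZero.ne q
  have hq2 : 2 ≤ q := by omega
  have hq0 : (0:ℝ) < q := by positivity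
  have hq2' : (2:ℝ) ≤ q := by exact_mod_cast hq2
  have h := norm_LFunction_one_le_of_odd_param χ hχ hodd (N := 1) le_rfl (by omega)
  have hzero : ((1 : ℕ) : ℝ) / 3 - 1 / 2 + 1 / (6 * ((1 : ℕ) : ℝ)) = 0 := by norm_num
  rw [hzero, mul_zero, add_zero, Nat.cast_one] at h
  have hlog : Real.log (2 * π * (1 / (q:ℝ))) = Real.log 2 + Real.log π - Real.log q := by
    rw [Real.log_mul (by positivity) (by positivity), Real.log_mul two_ne_zero Real.pi_ne_zero,
      one_div, Real.log_inv]; ring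
  rw [hlog] at h
  have hl6 : Real.log 6 = Real.log 2 + Real.log 3 := by
    rw [show (6:ℝ) = 2 * 3 by norm_num, Real.log_mul two_ne_zero three_ne_zero]
  have hπ3 := log_pi_sub_log_three_gt
  have hl2 := Real.log_two_lt_d9
  have hpi := Real.pi_lt_d4
  have hxq : π * (1 / (q:ℝ)) ≤ π / 2 := by
    rw [mul_one_div]; exact div_le_div_of_nonneg_left Real.pi_pos.le two_pos hq2'
  have hx0 : 0 ≤ π * (1 / (q:ℝ)) := by positivity
  by_cases h4 : q ≤ 4
  · have hlogq : Real.log q ≤ 2 * Real.log 2 := by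
      have : Real.log q ≤ Real.log 4 := Real.log_le_log hq0 (by exact_mod_cast h4)
      rw [show (4:ℝ) = 2 ^ 2 by norm_num, Real.log_pow] at this
      exact_mod_cast this
    have hx2 : (π * (1 / (q:ℝ))) ^ 2 ≤ 2.4675 := by nlinarith [mul_le_mul hxq hxq hx0 (by positivity)]
    have hε := (sq_div_le hx2 (by norm_num)).trans
      (show (2.4675:ℝ) / (6 * (6 - 2.4675)) ≤ 0.1165 by norm_num)
    linarith only [h, hε, hlogq, hl2, hπ3, hl6]
  · have h5 : (5:ℝ) ≤ q := by exact_mod_cast (show 5 ≤ q by omega)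
    have hlogq : Real.log q ≤ 2 := by
      rw [Real.log_le_iff_le_exp hq0]
      have he := Real.exp_one_gt_d9
      have : Real.exp 2 = Real.exp 1 ^ 2 := by rw [← Real.exp_nat_mul]; norm_num
      rw [this]
      have hq6 : (q:ℝ) ≤ 6 := by exact_mod_cast hq
      nlinarith
    have hxq5 : π * (1 / (q:ℝ)) ≤ π / 5 := by
      rw [mul_one_div]; exact div_le_div_of_nonneg_left Real.pi_pos.le (by norm_num) h5
    have hx2 : (π * (1 / (q:ℝ))) ^ 2 ≤ 0.3948 := by nlinarith [mul_le_mul hxq5 hxq5 hx0 (by positivity)]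
    have hε := (sq_div_le hx2 (by norm_num)).trans
      (show (0.3948:ℝ) / (6 * (6 - 0.3948)) ≤ 0.01175 by norm_num)
    linarith only [h, hε, hlogq, hπ3, hl6]

/-- **Large conductors** (`q ≥ 7`, `δ = N/q`, `N = ⌊3√q/π⌋`): `|L(1,χ)| ≤ ½ log q + 5/2 − log 6` for
odd primitive `χ` («the near-optimal value for `δ` is given by `πδ√q/3 = 1`»).
[cite: Ramare2001LOneApproximateFormulae, (6.5) p. 263] -/
theorem norm_LFunction_one_le_of_odd_large (hχ : χ.IsPrimitive) (hodd : χ.Odd) (hq : 7 ≤ q) :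
    ‖χ.LFunction 1‖ ≤ Real.log q / 2 + (5 / 2 - Real.log 6) := by
  have hqne : q ≠ 0 := NeZero.ne q
  have hq0 : (0:ℝ) < q := by positivity
  have hq7 : (7:ℝ) ≤ q := by exact_mod_cast hq
  set s : ℝ := Real.sqrt q with hs
  clear_value s
  have hs0 : 0 < s := by rw [hs]; exact Real.sqrt_pos.2 hq0
  have hsq : s ^ 2 = q := by rw [hs]; exact Real.sq_sqrt hq0.le
  have hs2 : 2.6 < s := by nlinarith
  have hpi := Real.pi_lt_d2
  have hpi3 := Real.pi_gt_three
  set a : ℝ := 3 * s / π with ha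
  clear_value a
  have ha0 : 0 < a := by rw [ha]; positivity
  have h3s : 3 * s = π * a := by rw [ha]; field_simp
  have ha2 : (2:ℝ) ≤ a := by nlinarith [Real.pi_pos]
  set N : ℕ := ⌊a⌋₊ with hN
  have hN2 : 2 ≤ N := Nat.le_floor (by exact_mod_cast ha2)
  have hNa : (N:ℝ) ≤ a := Nat.floor_le ha0.le
  have haN : a < N + 1 := Nat.lt_floor_add_one a
  clear_value N
  have hN2' : (2:ℝ) ≤ N := by exact_mod_cast hN2
  have has : a < s := by
    have h1 : π * a < π * s := by nlinarith [mul_pos hs0 (sub_pos.2 hpi3)]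
    exact lt_of_mul_lt_mul_left h1 Real.pi_pos.le
  have h2N : 2 * N ≤ q := by
    have : 2 * (N:ℝ) ≤ q := by nlinarith [mul_nonneg hs0.le (show (0:ℝ) ≤ s - 2 by linarith)]
    exact_mod_cast this
  have h := norm_LFunction_one_le_of_odd_param χ hχ hodd (N := N) (by omega) h2N
  -- rewrite the logarithm and `π/√q`
  have hN0 : (0:ℝ) < N := by linarith
  have hlog : Real.log (2 * π * ((N:ℝ) / q)) = Real.log 2 + Real.log π + Real.log N - 2 * Real.log s := by
    rw [Real.log_mul (by positivity) (by positivity), Real.log_mul two_ne_zero Real.pi_ne_zero,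
      Real.log_div hN0.ne' hq0.ne', ← hsq, Real.log_pow]; push_cast; ring
  have hlogq : Real.log q = 2 * Real.log s := by rw [← hsq, Real.log_pow]; push_cast; ring
  have hl6 : Real.log 6 = Real.log 2 + Real.log 3 := by
    rw [show (6:ℝ) = 2 * 3 by norm_num, Real.log_mul two_ne_zero three_ne_zero]
  have hπs : π / Real.sqrt q = 3 / a := by
    rw [← hs, div_eq_div_iff hs0.ne' ha0.ne']; linarith
  -- `log(a/N) ≤ a/N − 1`
  have hlogaN : Real.log 3 + Real.log s - Real.log π - Real.log N ≤ a / N - 1 := by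
    have h1 := Real.log_le_sub_one_of_pos (show 0 < a / N by positivity)
    have ha' : a = 3 * s / π := by field_simp; linarith
    have hloga : Real.log a = Real.log 3 + Real.log s - Real.log π := by
      rw [ha', Real.log_div (by positivity) Real.pi_ne_zero, Real.log_mul three_ne_zero hs0.ne']
    rw [Real.log_div ha0.ne' hN0.ne'] at h1
    linarith
  -- the `ε` term
  set ε : ℝ := (π * ((N:ℝ) / q)) ^ 2 / (6 * (6 - (π * ((N:ℝ) / q)) ^ 2)) with hε
  clear_value ε
  have he : (π * ((N:ℝ) / q)) ^ 2 ≤ 9 / q := by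
    have hπN : π * (N:ℝ) ≤ 3 * s := by
      have := mul_le_mul_of_nonneg_left hNa Real.pi_pos.le
      linarith
    have h1 : π * ((N:ℝ) / q) ≤ 3 / s := by
      rw [mul_div_assoc', div_le_div_iff₀ hq0 hs0]
      nlinarith [mul_le_mul_of_nonneg_right hπN hs0.le]
    have h0 : 0 ≤ π * ((N:ℝ) / q) := by positivity
    calc (π * ((N:ℝ) / q)) ^ 2 ≤ (3 / s) ^ 2 := pow_le_pow_left₀ h0 h1 2
      _ = 9 / q := by rw [div_pow, hsq]; norm_num
  have h97 : (9:ℝ) / q ≤ 9 / 7 := div_le_div_of_nonneg_left (by norm_num) (by norm_num) hq7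
  have hεle : ε ≤ (9 / q) / (6 * (6 - 9 / 7)) := by
    rw [hε]
    refine (sq_div_le he (by linarith)).trans ?_
    exact div_le_div_of_nonneg_left (by positivity) (by norm_num) (by linarith)
  have hε0 : 0 ≤ ε := by
    rw [hε]; exact div_nonneg (sq_nonneg _) (by linarith [he, h97])
  have haNε : a * N * ε ≤ 1 := by
    have h1 : a * N ≤ a * a := mul_le_mul_of_nonneg_left hNa ha0.le
    have h2 : a * a = 9 * q / π ^ 2 := by
      have hsq3 : (3 * s) ^ 2 = (π * a) ^ 2 := by rw [h3s]
      rw [← hsq, eq_div_iff (by positivity)]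
      linear_combination (-1 : ℝ) * hsq3
    have h3 : a * N * ε ≤ (9 * q / π ^ 2) * ((9 / q) / (6 * (6 - 9 / 7))) := by
      calc a * N * ε ≤ a * a * ε := mul_le_mul_of_nonneg_right h1 hε0
        _ ≤ a * a * ((9 / q) / (6 * (6 - 9 / 7))) := mul_le_mul_of_nonneg_left hεle (by positivity)
        _ = _ := by rw [h2]
    have h4 : (9 * q / π ^ 2) * ((9 / q) / (6 * (6 - 9 / 7))) = 567 / (198 * π ^ 2) := by
      field_simp; ring
    rw [h4] at h3
    have h5 : (567:ℝ) / (198 * π ^ 2) ≤ 1 := by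
      rw [div_le_one (by positivity)]
      nlinarith [mul_self_le_mul_self (by norm_num : (0:ℝ) ≤ 3) hpi3.le]
    linarith only [h3, h5]
  have hineq := odd_large_ineq hN2' hNa haN haNε
  rw [hlog, hπs] at h
  rw [hlogq, hl6]
  linarith only [h, hlogaN, hineq]

/-- **Ramaré 2001, Corollary 1 (odd characters)**: for every odd primitive Dirichlet character `χ`
mod `q`, `|L(1,χ)| ≤ ½ log q + 5/2 − log 6` (`= ½ log q + 0.7082…`).  The odd conjunct of the named
fact `Literature.NumberTheory.LFunctions.ramare2001_corollary1`.
[cite: Ramare2001LOneApproximateFormulae, Cor. 1 p. 248] -/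
theorem norm_LFunction_one_le_half_log_add_of_odd (hχ : χ.IsPrimitive) (hodd : χ.Odd) :
    ‖χ.LFunction 1‖ ≤ Real.log q / 2 + (5 / 2 - Real.log 6) := by
  by_cases hq : q ≤ 6
  · exact norm_LFunction_one_le_of_odd_small χ hχ hodd hq
  · exact norm_LFunction_one_le_of_odd_large χ hχ hodd (by omega)

/-- The odd conjunct of `ramare2001_corollary1`, in its quantified shape.
[cite: Ramare2001LOneApproximateFormulae, Cor. 1 p. 248] -/
theorem ramare2001_corollary1_odd :
    ∀ (q : ℕ) [NeZero q] (χ : DirichletCharacter ℂ q), χ.IsPrimitive → χ ≠ 1 → χ.Odd →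
      ‖χ.LFunction 1‖ ≤ Real.log q / 2 + (5 / 2 - Real.log 6) :=
  fun _ _ χ hχ _ hodd => norm_LFunction_one_le_half_log_add_of_odd χ hχ hodd

end Literature.NumberTheory.LFunctions.Ramare2001
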